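import Summits.QuantumFields.YangMills.Theorems.UnitScaleTiltProp7LODCutoffLetters
import HarnessLib

/-!
# Route `UnitScaleTilt`, crux K1 «MinimiserStabilityRegPr» (stmt-QuantumFields-19200), EX row `hGF` (curved member), the LOD line — **PEN (L6-χ), FILE D: THE (χ)-DOCK OF THE
# (L6) KNIT.  The cut-off operators `M_c : E →ₗ E`, `N₂,c : S →ₗ S`, `N₃,c : C →ₗ C` of w5 g13's `Prop7LODAssembly.curvedTarget_of_LOD` (binders (χ): `Σ_c ‖M_c A‖² = ‖A‖²`,
# `Σ_c ‖N_{2,c} y‖² ≤ ‖y‖²`, `Σ_c ‖N_{3,c} z‖² ≤ ‖z‖²`) BUILT FROM THE QUADRATIC PARTITION ✓`Prop7LODCutoffLetters.exists_sqPartition`, indexed by ALL fine sites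
# (`J := Site (F.P K) 0`, zero operators off the centre set), with their (Z2) readings and the (χ2) commutator rows attached.**

Cell `ym3-torus` (HUMAN RULING D-0037: YM₃ on T³ is ladder rung R3 — NOT d = 4, NOT infinite volume, NOT a mass gap, NOT Clay).  Width seat `ym3-torus-px17` (gen 8);
FILES A∕B∕C ✓p752168∕✓p753060∕✓p753149.  THEOREMS ONLY (0 `def`, 0 `sorry`); `--supports stmt-QuantumFields-19200 --as helper`, count-neutral.  HONEST LABEL (№33 (6)):
bookkeeping — the three operator families and the EQUALITIES `Σ_c ‖·‖² = ‖·‖²` (so the knit's `hM`, `hN₂`, `hN₃` hold with `=`∕`≤`); the knit's other rows (H)(K)(C) are NOT here;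
nothing of (L6), `hGF`, `h349`, EX or the crux is proved.

THE MATHEMATICS.  For a real weight `ρ` read at the source of a bond (resp. at a site, resp. at a coarse bond through ANY reading map `g : PBond (F.P n) 0 → Site (F.P K) 0` —
the assembler takes the block corner), the multiplication operator on the weighted `L²` space has `‖ρ•f‖² = c·Σ ρ² hs(f)` (Frobenius letters ✓`norm_sq_toL2`∕`norm_sq_toL2S`∕
`norm_sq_toL2B`, ✓`hs_smul`); summing over the family and using `Σ_c χ_c(x)² = 1` AT EVERY FINE SITE gives the three identities.  `E = BondL2K ℂ 3 (periodsT3 F K) c₀ W₂`,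
`S = SiteL2K ℂ 3 (periodsT3 F K) c₀ W₂`, `C = WL2 ℂ (fun _ : PBond (F.P n) 0 => cB) W₂` (the target of `Qk`).

WHAT IS PROVED (ns `…Theorems.Prop7LODCutoffDock`): §1 `exists_bondMulB` (the coarse multiplier, ∃-form), `normSq_of_bondReading`, `normSq_of_siteReading`, `normSq_of_bondReadingB`
(norm formulas from the readings); §2 `sum_sq_univ_eq_one` (the partition summed over ALL sites), `sum_normSq_bondMul_eq`, `sum_normSq_siteMul_eq`, `sum_normSq_bondMulB_eq`;
§3 ★★★ `exists_LOD_cutoffs (s) (hnK : n < K) (hs : s < F.m + n) (g)` — the dock; ★★★ `exists_LOD_cutoffs_corner (h) (s) (hnK) (hs)` — the same at the reading map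
of record `g bc := Site.fibreSite 0 (K−n) (bondShift (sites_eq F n K h) bc).src 0` (routeR-w4 g26's `hK₃` letter: the corner of `ĉ₋`'s block).

References: T. Bałaban, CMP **99** (1985) 389–434 [Balaban1985BackgroundPropagators] ((3.11) p.392, (3.16) p.393, (3.100) pp.413–414); B. Simon, Ann. IHP A **38** (1983) 295–308 (IMS).
-/

set_option autoImplicit false

noncomputable section

open scoped BigOperators Matrix.Norms.L2Operator Matrix

namespace Summit.QuantumFields.YangMills.Theorems.Prop7LODCutoffDock

open Literature.MathematicalPhysics.QuantumFieldTheory.Balaban1983to89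
open Literature.MathematicalPhysics.QuantumFieldTheory.Balaban1983to89.T3ContinuumYM3Torus
open T3SectALandauChart (eta eta_pos)
open B9Eq311L2Pairing (WL2)
open B11Eq103H1Complex (SiteL2K BondL2K)
open Summit.QuantumFields.YangMills.Theorems.Prop7SectET3Transport (periodsT3)
open T3PrintedRegularOrbits (sites_eq)
open T3LevelShift (bondShift)
open Summit.QuantumFields.YangMills.Theorems.Prop7SectET3HilbertLetters (W₂ toL2 toL2S toL2B DL2 DstarL2)
open Summit.QuantumFields.YangMills.Theorems.Prop7LaplaceAFlatLetters (norm_sq_toL2 norm_sq_toL2S norm_sq_toL2B)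
open Summit.QuantumFields.YangMills.Theorems.Prop7CovAgmonLetters (hs_smul)
open Summit.QuantumFields.YangMills.Theorems.Prop7Lane2CutoffOps (exists_cutoffOps)
open Summit.QuantumFields.YangMills.Theorems.Prop7LODCutoffLetters (exists_sqPartition normSq_comm_rows_of_readings three_mul_sq_step_mul_inv_eta_sq)

variable (F : T3Family) (n K : ℕ) (c₀ cB : ℝ) [Fact (0 < c₀)] [Fact (0 < cB)]

/-! ## §1 Multipliers and their norms from the readings -/

omit [Fact (0 < c₀)] [Fact (0 < cB)] in
/-- a real multiplier on the COARSE bond space `C` (the target of `Q_k`), ∃-form with its `toL2B` reading. [cite: Balaban1985BackgroundPropagators, (3.16) p.393] -/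
theorem exists_bondMulB (ρ : PBond (F.P n) 0 → ℝ) :
    ∃ N : WL2 ℂ (fun _ : PBond (F.P n) 0 => cB) W₂ →ₗ[ℂ] WL2 ℂ (fun _ : PBond (F.P n) 0 => cB) W₂,
      ∀ z bc, (toL2B F n cB).symm (N z) bc = ρ bc • (toL2B F n cB).symm z bc := by
  let mB : (PBond (F.P n) 0 → Matrix (Fin 2) (Fin 2) ℂ) →ₗ[ℂ] (PBond (F.P n) 0 → Matrix (Fin 2) (Fin 2) ℂ) :=
    { toFun := fun g b => ((ρ b : ℝ) : ℂ) • g b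
      map_add' := fun g g' => by funext b; simp only [Pi.add_apply, smul_add]
      map_smul' := fun r g => by funext b; simp only [Pi.smul_apply, RingHom.id_apply, smul_comm r] }
  refine ⟨(toL2B F n cB).toLinearMap ∘ₗ mB ∘ₗ (toL2B F n cB).symm.toLinearMap, fun z bc => ?_⟩
  show (toL2B F n cB).symm (toL2B F n cB (mB ((toL2B F n cB).symm z))) bc = _
  rw [LinearEquiv.symm_apply_apply]
  exact Complex.coe_smul _ _

omit [Fact (0 < cB)] in
/-- `‖Zb f‖² = c₀·Σ_b ρ(b₋)²·hs(f b)` for any operator with the bond reading `toL2⁻¹(Zb f) b = ρ(b₋) • toL2⁻¹ f b`. [cite: Balaban1985BackgroundPropagators, (3.11) p.392] -/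
theorem normSq_of_bondReading (ρ : Site (F.P K) 0 → ℝ) (Zb : BondL2K ℂ 3 (periodsT3 F K) c₀ W₂ →ₗ[ℂ] BondL2K ℂ 3 (periodsT3 F K) c₀ W₂)
    (hZb : ∀ f b, (toL2 F K c₀).symm (Zb f) b = ρ b.src • (toL2 F K c₀).symm f b) (f : BondL2K ℂ 3 (periodsT3 F K) c₀ W₂) :
    ‖Zb f‖ ^ 2 = c₀ * ∑ b : PBond (F.P K) 0, ρ b.src ^ 2 * ∑ i : Fin 2, ∑ i' : Fin 2, ‖(toL2 F K c₀).symm f b i i'‖ ^ 2 := by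
  have e1 : Zb f = toL2 F K c₀ (fun b => ρ b.src • (toL2 F K c₀).symm f b) := by
    apply (toL2 F K c₀).symm.injective
    rw [LinearEquiv.symm_apply_apply]; funext b; exact hZb f b
  rw [e1, norm_sq_toL2]
  congr 1
  exact Finset.sum_congr rfl fun b _ => hs_smul _ _

omit [Fact (0 < cB)] in
/-- `‖Zs φ‖² = c₀·Σ_x ρ(x)²·hs(φ x)` for any operator with the site reading. [cite: Balaban1985BackgroundPropagators, (3.11) p.392] -/
theorem normSq_of_siteReading (ρ : Site (F.P K) 0 → ℝ) (Zs : SiteL2K ℂ 3 (periodsT3 F K) c₀ W₂ →ₗ[ℂ] SiteL2K ℂ 3 (periodsT3 F K) c₀ W₂)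
    (hZs : ∀ φ x, (toL2S F K c₀).symm (Zs φ) x = ρ x • (toL2S F K c₀).symm φ x) (φ : SiteL2K ℂ 3 (periodsT3 F K) c₀ W₂) :
    ‖Zs φ‖ ^ 2 = c₀ * ∑ x : Site (F.P K) 0, ρ x ^ 2 * ∑ i : Fin 2, ∑ i' : Fin 2, ‖(toL2S F K c₀).symm φ x i i'‖ ^ 2 := by
  have e1 : Zs φ = toL2S F K c₀ (fun x => ρ x • (toL2S F K c₀).symm φ x) := by
    apply (toL2S F K c₀).symm.injective
    rw [LinearEquiv.symm_apply_apply]; funext x; exact hZs φ x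
  rw [e1, norm_sq_toL2S]
  congr 1
  exact Finset.sum_congr rfl fun x _ => hs_smul _ _

omit [Fact (0 < c₀)] in
/-- `‖N z‖² = cB·Σ_{bc} ρ(bc)²·hs(z bc)` for any operator with the coarse reading. [cite: Balaban1985BackgroundPropagators, (3.16) p.393] -/
theorem normSq_of_bondReadingB (ρ : PBond (F.P n) 0 → ℝ)
    (N : WL2 ℂ (fun _ : PBond (F.P n) 0 => cB) W₂ →ₗ[ℂ] WL2 ℂ (fun _ : PBond (F.P n) 0 => cB) W₂)
    (hN : ∀ z bc, (toL2B F n cB).symm (N z) bc = ρ bc • (toL2B F n cB).symm z bc) (z : WL2 ℂ (fun _ : PBond (F.P n) 0 => cB) W₂) :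
    ‖N z‖ ^ 2 = cB * ∑ bc : PBond (F.P n) 0, ρ bc ^ 2 * ∑ i : Fin 2, ∑ i' : Fin 2, ‖(toL2B F n cB).symm z bc i i'‖ ^ 2 := by
  have e1 : N z = toL2B F n cB (fun bc => ρ bc • (toL2B F n cB).symm z bc) := by
    apply (toL2B F n cB).symm.injective
    rw [LinearEquiv.symm_apply_apply]; funext bc; exact hN z bc
  rw [e1, norm_sq_toL2B]
  congr 1
  exact Finset.sum_congr rfl fun bc _ => hs_smul _ _

/-! ## §2 Summing over the family with `Σ_c χ_c² = 1` -/

omit [Fact (0 < c₀)] [Fact (0 < cB)] in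
/-- the partition row summed over ALL fine sites (the weights vanish off the centre set). [cite: Balaban1985BackgroundPropagators, (3.100) pp.413-414] -/
theorem sum_sq_univ_eq_one {Zc : Finset (Site (F.P K) 0)} {χ : Site (F.P K) 0 → Site (F.P K) 0 → ℝ}
    (hsq : ∀ x, ∑ c ∈ Zc, χ c x ^ 2 = 1) (hoff : ∀ c, c ∉ Zc → ∀ x, χ c x = 0) (x : Site (F.P K) 0) :
    ∑ c : Site (F.P K) 0, χ c x ^ 2 = 1 := by
  rw [← hsq x]
  symm
  exact Finset.sum_subset (Finset.subset_univ Zc) fun c _ hc => by rw [hoff c hc x, zero_pow two_ne_zero]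

omit [Fact (0 < cB)] in
/-- `Σ_c ‖M_c f‖² = ‖f‖²` for bond multipliers by a quadratic partition read at the source. [cite: Balaban1985BackgroundPropagators, (3.11) p.392, (3.100) pp.413-414] -/
theorem sum_normSq_bondMul_eq {χ : Site (F.P K) 0 → Site (F.P K) 0 → ℝ} (h1 : ∀ x, ∑ c : Site (F.P K) 0, χ c x ^ 2 = 1)
    (M : Site (F.P K) 0 → (BondL2K ℂ 3 (periodsT3 F K) c₀ W₂ →ₗ[ℂ] BondL2K ℂ 3 (periodsT3 F K) c₀ W₂))
    (hM : ∀ c f b, (toL2 F K c₀).symm (M c f) b = χ c b.src • (toL2 F K c₀).symm f b) (f : BondL2K ℂ 3 (periodsT3 F K) c₀ W₂) :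
    ∑ c : Site (F.P K) 0, ‖M c f‖ ^ 2 = ‖f‖ ^ 2 := by
  have hf : ‖f‖ ^ 2 = c₀ * ∑ b : PBond (F.P K) 0, ∑ i : Fin 2, ∑ i' : Fin 2, ‖(toL2 F K c₀).symm f b i i'‖ ^ 2 := by
    conv_lhs => rw [← (toL2 F K c₀).apply_symm_apply f]
    exact norm_sq_toL2 _
  rw [hf, Finset.sum_congr rfl fun c _ => normSq_of_bondReading F K c₀ (χ c) (M c) (hM c) f, ← Finset.mul_sum, Finset.sum_comm]
  congr 1
  refine Finset.sum_congr rfl fun b _ => ?_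
  rw [← Finset.sum_mul, h1 b.src, one_mul]

omit [Fact (0 < cB)] in
/-- `Σ_c ‖N_{2,c} φ‖² = ‖φ‖²` for site multipliers by a quadratic partition. [cite: Balaban1985BackgroundPropagators, (3.11) p.392, (3.100) pp.413-414] -/
theorem sum_normSq_siteMul_eq {χ : Site (F.P K) 0 → Site (F.P K) 0 → ℝ} (h1 : ∀ x, ∑ c : Site (F.P K) 0, χ c x ^ 2 = 1)
    (N : Site (F.P K) 0 → (SiteL2K ℂ 3 (periodsT3 F K) c₀ W₂ →ₗ[ℂ] SiteL2K ℂ 3 (periodsT3 F K) c₀ W₂))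
    (hN : ∀ c φ x, (toL2S F K c₀).symm (N c φ) x = χ c x • (toL2S F K c₀).symm φ x) (φ : SiteL2K ℂ 3 (periodsT3 F K) c₀ W₂) :
    ∑ c : Site (F.P K) 0, ‖N c φ‖ ^ 2 = ‖φ‖ ^ 2 := by
  have hf : ‖φ‖ ^ 2 = c₀ * ∑ x : Site (F.P K) 0, ∑ i : Fin 2, ∑ i' : Fin 2, ‖(toL2S F K c₀).symm φ x i i'‖ ^ 2 := by
    conv_lhs => rw [← (toL2S F K c₀).apply_symm_apply φ]
    exact norm_sq_toL2S _
  rw [hf, Finset.sum_congr rfl fun c _ => normSq_of_siteReading F K c₀ (χ c) (N c) (hN c) φ, ← Finset.mul_sum, Finset.sum_comm]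
  congr 1
  refine Finset.sum_congr rfl fun x _ => ?_
  rw [← Finset.sum_mul, h1 x, one_mul]

omit [Fact (0 < c₀)] in
/-- `Σ_c ‖N_{3,c} z‖² = ‖z‖²` for coarse multipliers by `χ_c ∘ g`, `g` ANY reading map from coarse bonds to fine sites (the partition row holds at every fine site).
[cite: Balaban1985BackgroundPropagators, (3.16) p.393, (3.100) pp.413-414] -/
theorem sum_normSq_bondMulB_eq {χ : Site (F.P K) 0 → Site (F.P K) 0 → ℝ} (h1 : ∀ x, ∑ c : Site (F.P K) 0, χ c x ^ 2 = 1)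
    (g : PBond (F.P n) 0 → Site (F.P K) 0)
    (N : Site (F.P K) 0 → (WL2 ℂ (fun _ : PBond (F.P n) 0 => cB) W₂ →ₗ[ℂ] WL2 ℂ (fun _ : PBond (F.P n) 0 => cB) W₂))
    (hN : ∀ c z bc, (toL2B F n cB).symm (N c z) bc = χ c (g bc) • (toL2B F n cB).symm z bc) (z : WL2 ℂ (fun _ : PBond (F.P n) 0 => cB) W₂) :
    ∑ c : Site (F.P K) 0, ‖N c z‖ ^ 2 = ‖z‖ ^ 2 := by
  have hf : ‖z‖ ^ 2 = cB * ∑ bc : PBond (F.P n) 0, ∑ i : Fin 2, ∑ i' : Fin 2, ‖(toL2B F n cB).symm z bc i i'‖ ^ 2 := by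
    conv_lhs => rw [← (toL2B F n cB).apply_symm_apply z]
    exact norm_sq_toL2B _
  rw [hf, Finset.sum_congr rfl fun c _ => normSq_of_bondReadingB F n cB (fun bc => χ c (g bc)) (N c) (hN c) z, ← Finset.mul_sum, Finset.sum_comm]
  congr 1
  refine Finset.sum_congr rfl fun bc _ => ?_
  rw [← Finset.sum_mul, h1 (g bc), one_mul]

/-! ## §3 ★★★ The dock -/

/-- ★★★ **THE (χ)-BINDERS OF THE (L6) KNIT, SUPPLIED.**  For `n < K`, `s < m + n` and ANY coarse reading map `g : PBond (F.P n) 0 → Site (F.P K) 0`: the quadratic partition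
`χ` of ✓`exists_sqPartition` (all its rows re-exported) together with operator families indexed by ALL fine sites `c` — `M c` (bonds, weight `χ_c(b₋)`), `N₂ c` (sites, `χ_c(x)`),
`N₃ c` (coarse bonds, `χ_c(g bc)`) — with their readings, the IDENTITIES `Σ_c ‖M c f‖² = ‖f‖²`, `Σ_c ‖N₂ c φ‖² = ‖φ‖²`, `Σ_c ‖N₃ c z‖² = ‖z‖²` (so `hM`, `hN₂`, `hN₃` of
✓∕⧗`Prop7LODAssembly.curvedTarget_of_LOD` hold with `J := Site (F.P K) 0`), and the (χ2) commutator rows `‖D_W(N₂ c φ) − M c (D_W φ)‖², ‖D*_W(M c f) − N₂ c (D*_W f)‖² ≤ 4374·(L^s)⁻²·‖·‖²`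
for every background `W`. [cite: Balaban1985BackgroundPropagators, (3.11) p.392, (3.16) p.393, (3.100) pp.413-414] -/
theorem exists_LOD_cutoffs (s : ℕ) (hnK : n < K) (hs : s < F.m + n) (g : PBond (F.P n) 0 → Site (F.P K) 0) :
    ∃ (Zc : Finset (Site (F.P K) 0)) (χ : Site (F.P K) 0 → Site (F.P K) 0 → ℝ)
      (M : Site (F.P K) 0 → (BondL2K ℂ 3 (periodsT3 F K) c₀ W₂ →ₗ[ℂ] BondL2K ℂ 3 (periodsT3 F K) c₀ W₂))
      (N₂ : Site (F.P K) 0 → (SiteL2K ℂ 3 (periodsT3 F K) c₀ W₂ →ₗ[ℂ] SiteL2K ℂ 3 (periodsT3 F K) c₀ W₂))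
      (N₃ : Site (F.P K) 0 → (WL2 ℂ (fun _ : PBond (F.P n) 0 => cB) W₂ →ₗ[ℂ] WL2 ℂ (fun _ : PBond (F.P n) 0 => cB) W₂)),
      -- the partition rows (✓`exists_sqPartition`, re-exported)
      (∀ c x, 0 ≤ χ c x ∧ χ c x ≤ 1) ∧ (∀ x, ∑ c ∈ Zc, χ c x ^ 2 = 1) ∧ (∀ x, ∑ c : Site (F.P K) 0, χ c x ^ 2 = 1) ∧
      (∀ c, c ∉ Zc → ∀ x, χ c x = 0) ∧
      (∀ c x, χ c x ≠ 0 → ∀ κ : Fin 3, min (x κ - c κ).val (c κ - x κ).val < F.L ^ s * F.L ^ (K - n)) ∧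
      (∀ x, (Zc.filter (fun c => χ c x ≠ 0)).card ≤ 8) ∧
      (∀ c x (μ : Fin 3), |χ c (x.shift μ) - χ c x| ≤ 27 * Real.sqrt 2 / ((F.L : ℝ) ^ s * (F.L : ℝ) ^ (K - n)) ∧
        |χ c (x.unshift μ) - χ c x| ≤ 27 * Real.sqrt 2 / ((F.L : ℝ) ^ s * (F.L : ℝ) ^ (K - n))) ∧
      (∀ x (μ : Fin 3), ∑ c ∈ Zc, (χ c (x.shift μ) - χ c x) ^ 2 ≤ 2880 / ((F.L : ℝ) ^ s * (F.L : ℝ) ^ (K - n)) ^ 2 ∧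
        ∑ c ∈ Zc, (χ c (x.unshift μ) - χ c x) ^ 2 ≤ 2880 / ((F.L : ℝ) ^ s * (F.L : ℝ) ^ (K - n)) ^ 2) ∧
      -- the readings
      (∀ c f b, (toL2 F K c₀).symm (M c f) b = χ c b.src • (toL2 F K c₀).symm f b) ∧
      (∀ c φ x, (toL2S F K c₀).symm (N₂ c φ) x = χ c x • (toL2S F K c₀).symm φ x) ∧
      (∀ c z bc, (toL2B F n cB).symm (N₃ c z) bc = χ c (g bc) • (toL2B F n cB).symm z bc) ∧
      -- the (χ) binders of the knit
      (∀ f, ∑ c : Site (F.P K) 0, ‖M c f‖ ^ 2 = ‖f‖ ^ 2) ∧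
      (∀ φ, ∑ c : Site (F.P K) 0, ‖N₂ c φ‖ ^ 2 = ‖φ‖ ^ 2) ∧
      (∀ z, ∑ c : Site (F.P K) 0, ‖N₃ c z‖ ^ 2 = ‖z‖ ^ 2) ∧
      -- the (χ2) commutator rows, every background
      (∀ c (W : GaugeField (F.P K) 0 (Matrix.specialUnitaryGroup (Fin 2) ℂ)) φ,
        ‖DL2 F n K c₀ W (N₂ c φ) - M c (DL2 F n K c₀ W φ)‖ ^ 2 ≤ 4374 * (((F.L : ℝ) ^ s) ^ 2)⁻¹ * ‖φ‖ ^ 2) ∧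
      (∀ c (W : GaugeField (F.P K) 0 (Matrix.specialUnitaryGroup (Fin 2) ℂ)) f,
        ‖DstarL2 F n K c₀ W (M c f) - N₂ c (DstarL2 F n K c₀ W f)‖ ^ 2 ≤ 4374 * (((F.L : ℝ) ^ s) ^ 2)⁻¹ * ‖f‖ ^ 2) := by
  obtain ⟨Zc, χ, h01, hsq, hoff, hsupp, hcard, hstep, hfam⟩ := exists_sqPartition F n K s hnK hs
  have h1 : ∀ x, ∑ c : Site (F.P K) 0, χ c x ^ 2 = 1 := sum_sq_univ_eq_one F K hsq hoff
  -- the three operator families, by choice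
  have hops := fun c => exists_cutoffOps F K c₀ (χ c)
  choose Zs Zb hZs hZb using hops
  have hopsB := fun c => exists_bondMulB F n cB (fun bc => χ c (g bc))
  choose NB hNB using hopsB
  refine ⟨Zc, χ, Zb, Zs, NB, h01, hsq, h1, hoff, hsupp, hcard, hstep, hfam, fun c => hZb c, fun c => hZs c, fun c => hNB c,
    sum_normSq_bondMul_eq F K c₀ h1 Zb (fun c => hZb c), sum_normSq_siteMul_eq F K c₀ h1 Zs (fun c => hZs c),
    sum_normSq_bondMulB_eq F n K cB h1 g NB (fun c => hNB c), fun c W φ => ?_, fun c W f => ?_⟩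
  · have h := (normSq_comm_rows_of_readings F n K c₀ W (χ c) (fun x μ => (hstep c x μ).1) (Zs c) (Zb c) (hZs c) (hZb c)).1 φ
    rw [three_mul_sq_step_mul_inv_eta_sq] at h
    exact h
  · have h := (normSq_comm_rows_of_readings F n K c₀ W (χ c) (fun x μ => (hstep c x μ).1) (Zs c) (Zb c) (hZs c) (hZb c)).2 f
    rw [three_mul_sq_step_mul_inv_eta_sq] at h
    exact h

/-- ★★★ **THE DOCK AT THE READING MAP OF RECORD** (routeR-w4 g26's `hK₃`, 2026-08-30): `g bc :=` the CORNER (lowest label) of the `(K−n)`-block `ĉ₋`,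
`ĉ := bondShift (sites_eq F n K h) bc` — `exists_LOD_cutoffs` at that `g`, nothing else. [cite: Balaban1985BackgroundPropagators, (3.16) p.393, (3.100) pp.413-414] -/
theorem exists_LOD_cutoffs_corner (h : n ≤ K) (s : ℕ) (hnK : n < K) (hs : s < F.m + n) :
    ∃ (Zc : Finset (Site (F.P K) 0)) (χ : Site (F.P K) 0 → Site (F.P K) 0 → ℝ)
      (M : Site (F.P K) 0 → (BondL2K ℂ 3 (periodsT3 F K) c₀ W₂ →ₗ[ℂ] BondL2K ℂ 3 (periodsT3 F K) c₀ W₂))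
      (N₂ : Site (F.P K) 0 → (SiteL2K ℂ 3 (periodsT3 F K) c₀ W₂ →ₗ[ℂ] SiteL2K ℂ 3 (periodsT3 F K) c₀ W₂))
      (N₃ : Site (F.P K) 0 → (WL2 ℂ (fun _ : PBond (F.P n) 0 => cB) W₂ →ₗ[ℂ] WL2 ℂ (fun _ : PBond (F.P n) 0 => cB) W₂)),
      (∀ c x, 0 ≤ χ c x ∧ χ c x ≤ 1) ∧ (∀ x, ∑ c ∈ Zc, χ c x ^ 2 = 1) ∧ (∀ x, ∑ c : Site (F.P K) 0, χ c x ^ 2 = 1) ∧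
      (∀ c, c ∉ Zc → ∀ x, χ c x = 0) ∧
      (∀ c x, χ c x ≠ 0 → ∀ κ : Fin 3, min (x κ - c κ).val (c κ - x κ).val < F.L ^ s * F.L ^ (K - n)) ∧
      (∀ x, (Zc.filter (fun c => χ c x ≠ 0)).card ≤ 8) ∧
      (∀ c x (μ : Fin 3), |χ c (x.shift μ) - χ c x| ≤ 27 * Real.sqrt 2 / ((F.L : ℝ) ^ s * (F.L : ℝ) ^ (K - n)) ∧
        |χ c (x.unshift μ) - χ c x| ≤ 27 * Real.sqrt 2 / ((F.L : ℝ) ^ s * (F.L : ℝ) ^ (K - n))) ∧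
      (∀ x (μ : Fin 3), ∑ c ∈ Zc, (χ c (x.shift μ) - χ c x) ^ 2 ≤ 2880 / ((F.L : ℝ) ^ s * (F.L : ℝ) ^ (K - n)) ^ 2 ∧
        ∑ c ∈ Zc, (χ c (x.unshift μ) - χ c x) ^ 2 ≤ 2880 / ((F.L : ℝ) ^ s * (F.L : ℝ) ^ (K - n)) ^ 2) ∧
      (∀ c f b, (toL2 F K c₀).symm (M c f) b = χ c b.src • (toL2 F K c₀).symm f b) ∧
      (∀ c φ x, (toL2S F K c₀).symm (N₂ c φ) x = χ c x • (toL2S F K c₀).symm φ x) ∧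
      (∀ c z bc, (toL2B F n cB).symm (N₃ c z) bc
        = χ c (Site.fibreSite 0 (K - n) (bondShift (sites_eq F n K h) bc).src (fun _ => ⟨0, pow_pos (F.P K).L_pos (K - n)⟩)) • (toL2B F n cB).symm z bc) ∧
      (∀ f, ∑ c : Site (F.P K) 0, ‖M c f‖ ^ 2 = ‖f‖ ^ 2) ∧
      (∀ φ, ∑ c : Site (F.P K) 0, ‖N₂ c φ‖ ^ 2 = ‖φ‖ ^ 2) ∧
      (∀ z, ∑ c : Site (F.P K) 0, ‖N₃ c z‖ ^ 2 = ‖z‖ ^ 2) ∧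
      (∀ c (W : GaugeField (F.P K) 0 (Matrix.specialUnitaryGroup (Fin 2) ℂ)) φ,
        ‖DL2 F n K c₀ W (N₂ c φ) - M c (DL2 F n K c₀ W φ)‖ ^ 2 ≤ 4374 * (((F.L : ℝ) ^ s) ^ 2)⁻¹ * ‖φ‖ ^ 2) ∧
      (∀ c (W : GaugeField (F.P K) 0 (Matrix.specialUnitaryGroup (Fin 2) ℂ)) f,
        ‖DstarL2 F n K c₀ W (M c f) - N₂ c (DstarL2 F n K c₀ W f)‖ ^ 2 ≤ 4374 * (((F.L : ℝ) ^ s) ^ 2)⁻¹ * ‖f‖ ^ 2) :=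
  exists_LOD_cutoffs F n K c₀ cB s hnK hs
    (fun bc => Site.fibreSite 0 (K - n) (bondShift (sites_eq F n K h) bc).src (fun _ => ⟨0, pow_pos (F.P K).L_pos (K - n)⟩))

end Summit.QuantumFields.YangMills.Theorems.Prop7LODCutoffDock

end
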